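/-
Copyright (c) 2026 the pub-hodgecm-mathlib formalisation cell (harness21).  Prover seat hodgecm-mathlib-K2E5-p17 (g8), Track B «K2-LIT»,
#184♮ = hLiu418 = `stmt-HodgeConjecture-24832`; socket #41 `sig_K2LiuSiegelEisensteinContinuation` — THE TOP, edition 3 «THE THREE KINDS» (author of record, LEAD F0P6-plan (g14)
BATCH #46 (a); auditor K2Liu-audit1 (g0) 15:16:34Z (iv) «when `Ec` splits by kind keep every package hypothesis-first with ∀-bound data, rank-1 in the CLEARED currency only»).
THEOREMS ONLY (no `def`, no `instance`, no notation, no named-fact hypothesis, no `sorry`); NO `Lines` import.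
-/
import Summits.HodgeConjecture.HodgeConjecture.Theorems.K2LiuSiegelEisensteinContinuationTop   -- ★ edition 1∕2 (this seat)
import Summits.HodgeConjecture.HodgeConjecture.Theorems.K2LiuContinuationPackageAlgebra        -- ★ `exists_height_floor`
import Summits.HodgeConjecture.HodgeConjecture.Theorems.K2LiuRankOneInnerWhittakerContinued   -- ★ (R1-γ) `add_le_merged_monomial` (this seat)
import HarnessLib

/-!
# Crux `HLiu418`, socket #41 — THE TOP, edition 3: THE THREE KINDS OF FOURIER INDEX — `S = 0` (rank zero: identity + middle + big cell), `S ≠ 0`, `det S = 0`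
# (rank one, CLEARED currency), `det S ≠ 0` (Whittaker) — dispatched into ★ Φ9's single lattice-indexed family, with ONE majorant and ONE growth letter assembled

Cell `hodgecm-mathlib`, crux item hLiu418 = `stmt-HodgeConjecture-24832` (helper lane until the typist's tie; count-neutral).

★ edition 2 `siegelEisensteinContinuation_of_rows₂` takes ONE lattice-indexed family `Ec` with (i)(ii), the carrier-generic coefficient identity, Φ9's majorant and summed growth.
The payers, however, come BY KIND (sheet fa2b1e3a29709f09 §2): rows G1–G4 pay the NON-DEGENERATE indices (the Whittaker term packages `EcW S`, `det S ≠ 0`), G5-b pays the RANK-ONE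
indices through the CLEARED package ★ `K2LiuSiegelEisensteinRankOneTermPackageCleared.exists_rankOne_package_cleared` (`Ec1 S`, `S ≠ 0`, `det S = 0`), and G5-a + G6 (Φ8, (MOD) ★) + the
identity cell pay the CONSTANT TERM (`Ec0`, `S = 0`).  THIS FILE is the dispatch: with the off-kind conventions `Ec1 S = 0` unless `S` is rank one and `EcW S = 0` unless `det S ≠ 0`
(the payers' natural extension by zero), the family `Ec S := 𝟙_{S=0}·Ec0 + Ec1 S + EcW S` satisfies edition 2's binders: (i)(ii) termwise; the coefficient identity kind by kind; ONE
locally uniform summable MAJORANT `𝟙_{S=0}·M + |m₁ S| + |m_W S|` from a local bound of `Ec0` and the two per-kind majorants; ONE summed GROWTH letter from the three per-kind growth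
letters (`‖Ec0‖ ≤ C₀‖h‖^{A₀}`, `Σ'_S ‖Ec1 S‖ ≤ C₁‖h‖^{A₁}`, `Σ'_S ‖EcW S‖ ≤ C_W‖h‖^{A_W}`), merged under the height floor of `H(𝔸)` (★ `exists_height_floor`, ★ (R1-γ)
`add_le_merged_monomial`).
HEADS **`siegelEisensteinContinuation_of_kinds`** (carrier-generic, over ★ edition 2) and **`…_of_kinds_fixedCarrier`** (carrier a binder, over ★ edition 1): socket binders, `P`, PER KIND
`(Ec₀ …) (Ec₁ …) (EcW …)` ⇒ socket #41's body BYTES VERBATIM.  Sources: [Tan1999, §1, §4 Props. 4.1, 4.4, 4.8]; [MoeglinWaldspurger1995, II.1.7, IV.1.8–IV.1.11]; [KudlaRallis1994, §1–§2].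
HONEST LABEL.  Count-neutral helper until tied; `HC_CM` is proved only modulo the 7 printed citations (2 remaining named inputs: hLiu418 = `stmt-HodgeConjecture-24832`,
h413 = `stmt-HodgeConjecture-24833`) until rung 0 closes.
-/

set_option autoImplicit false
set_option linter.dupNamespace false -- the mandated namespace repeats `HodgeConjecture.HodgeConjecture`

noncomputable section

open scoped Matrix Topology ENNReal NNReal BigOperators
open NumberField IsDedekindDomain MeasureTheory Filter
open Literature.NumberTheory.Automorphic Literature.NumberTheory.GaloisRepresentations
open Literature.NumberTheory.GelbartRogawski1991 Literature.NumberTheory.GelbartRogawski1991.GRConstruction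
open Literature.NumberTheory.K2Lit.SiegelDoubled Literature.MeasureTheory.Group
open Literature.NumberTheory.Automorphic.IdeleClassGroup

namespace Summit.HodgeConjecture.HodgeConjecture.Cruxes.HLiu418.K2LiuSiegelEisensteinContinuationTopKinds

open K2LiuSiegelUnipotentFourierDefs K2LiuSiegelEisensteinContinuationTop
open K2LiuContinuationPackageAlgebra (exists_height_floor)
open K2LiuRankOneInnerWhittakerContinued (add_le_merged_monomial)

/-! ## §1 Real-analysis devices for the dispatch -/

section Devices

/-- a monomial bound with an arbitrary constant is one with a non-negative constant. [folklore] -/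
theorem le_max_mul_rpow {u C h A : ℝ} (hh : 0 ≤ h) (hu : u ≤ C * h ^ A) : u ≤ max C 0 * h ^ A :=
  hu.trans (mul_le_mul_of_nonneg_right (le_max_left _ _) (Real.rpow_nonneg hh _))

/-- **three monomials merge into one under a floor** (★ (R1-γ) `add_le_merged_monomial` twice). [folklore] -/
theorem add_add_le_merged_monomial {m h u v w C₀ C₁ C₂ A₀ A₁ A₂ : ℝ} (hm : 0 < m) (hmh : m ≤ h) (hC₀ : 0 ≤ C₀) (hC₁ : 0 ≤ C₁) (hC₂ : 0 ≤ C₂)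
    (hu : u ≤ C₀ * h ^ A₀) (hv : v ≤ C₁ * h ^ A₁) (hw : w ≤ C₂ * h ^ A₂) :
    ∃ C A : ℝ, 0 ≤ C ∧ u + v + w ≤ C * h ^ A := by
  obtain h1 := add_le_merged_monomial hm hmh hC₀ hC₁ hu hv
  have hC' : 0 ≤ C₀ * m ^ (A₀ - max A₀ A₁) + C₁ * m ^ (A₁ - max A₀ A₁) := by positivity
  obtain h2 := add_le_merged_monomial hm hmh hC' hC₂ h1 hw
  exact ⟨_, _, by positivity, h2⟩

end Devices

/-! ## §2 The dispatched family and its letters -/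

section Kinds

variable (L : Type) [Field L] [NumberField L] [IsCMField L] {N M n : ℕ} (e : Fin N × Fin M ≃ Fin n)
  (dV : Fin N → L) (hdV : ∀ i, IsCMField.complexConj L (dV i) = dV i)
  (dW : Fin M → L) (hdW : ∀ i, IsCMField.complexConj L (dW i) = dW i)

open Classical in
/-- **ONE MAJORANT FROM THREE**: a local bound `M` of `Ec0`, and per-kind locally uniform summable majorants `m₁`, `m_W` of `Ec1`, `EcW` near `(z, h₀)` ⇒ the dispatched family
`𝟙_{S=0}·Ec0 + Ec1 S + EcW S` has the locally uniform summable majorant `𝟙_{S=0}·M + |m₁ S| + |m_W S|` — Φ9's `hmaj`. [cite: MoeglinWaldspurger1995, IV.1.8–IV.1.9] -/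
theorem majorant_of_kinds {X : Type*} [TopologicalSpace X]
    (Ec0 : ℂ → X → ℂ) (Ec1 EcW : skewMatrices ((IsCMField.complexConj L : L ≃ₐ[Fp L] L) : L →+* L) ((gramR L e dV hdV dW hdW).map (algebraMap (Fp L) L)) → ℂ → X → ℂ)
    (hbd0 : ∀ z : ℂ, 0 < z.re → ∀ x₀ : X, ∃ r > (0 : ℝ), ∃ V ∈ 𝓝 x₀, ∃ M : ℝ, ∀ s : ℂ, dist s z < r → ∀ x ∈ V, ‖Ec0 s x‖ ≤ M)
    (hmaj1 : ∀ z : ℂ, 0 < z.re → ∀ x₀ : X, ∃ r > (0 : ℝ), ∃ V ∈ 𝓝 x₀,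
      ∃ m : skewMatrices ((IsCMField.complexConj L : L ≃ₐ[Fp L] L) : L →+* L) ((gramR L e dV hdV dW hdW).map (algebraMap (Fp L) L)) → ℝ, Summable m ∧
        ∀ s : ℂ, dist s z < r → ∀ x ∈ V, ∀ S : skewMatrices ((IsCMField.complexConj L : L ≃ₐ[Fp L] L) : L →+* L) ((gramR L e dV hdV dW hdW).map (algebraMap (Fp L) L)), ‖Ec1 S s x‖ ≤ m S)
    (hWmaj : ∀ z : ℂ, 0 < z.re → ∀ x₀ : X, ∃ r > (0 : ℝ), ∃ V ∈ 𝓝 x₀,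
      ∃ m : skewMatrices ((IsCMField.complexConj L : L ≃ₐ[Fp L] L) : L →+* L) ((gramR L e dV hdV dW hdW).map (algebraMap (Fp L) L)) → ℝ, Summable m ∧
        ∀ s : ℂ, dist s z < r → ∀ x ∈ V, ∀ S : skewMatrices ((IsCMField.complexConj L : L ≃ₐ[Fp L] L) : L →+* L) ((gramR L e dV hdV dW hdW).map (algebraMap (Fp L) L)), ‖EcW S s x‖ ≤ m S) :
    ∀ z : ℂ, 0 < z.re → ∀ x₀ : X, ∃ r > (0 : ℝ), ∃ V ∈ 𝓝 x₀,
      ∃ m : skewMatrices ((IsCMField.complexConj L : L ≃ₐ[Fp L] L) : L →+* L) ((gramR L e dV hdV dW hdW).map (algebraMap (Fp L) L)) → ℝ, Summable m ∧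
        ∀ s : ℂ, dist s z < r → ∀ x ∈ V, ∀ S : skewMatrices ((IsCMField.complexConj L : L ≃ₐ[Fp L] L) : L →+* L) ((gramR L e dV hdV dW hdW).map (algebraMap (Fp L) L)),
          ‖(if (S : Matrix (Fin n) (Fin n) L) = 0 then Ec0 s x else 0) + Ec1 S s x + EcW S s x‖ ≤ m S := by
  intro z hz x₀
  obtain ⟨r₀, hr₀, V₀, hV₀, M, h0⟩ := hbd0 z hz x₀
  obtain ⟨r₁, hr₁, V₁, hV₁, m₁, hm₁, h1⟩ := hmaj1 z hz x₀
  obtain ⟨r₂, hr₂, V₂, hV₂, m₂, hm₂, h2⟩ := hWmaj z hz x₀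
  refine ⟨min r₀ (min r₁ r₂), lt_min hr₀ (lt_min hr₁ hr₂), V₀ ∩ (V₁ ∩ V₂), Filter.inter_mem hV₀ (Filter.inter_mem hV₁ hV₂),
    fun S : skewMatrices ((IsCMField.complexConj L : L ≃ₐ[Fp L] L) : L →+* L) ((gramR L e dV hdV dW hdW).map (algebraMap (Fp L) L)) => (if (S : Matrix (Fin n) (Fin n) L) = 0 then max M 0 else 0) + |m₁ S| + |m₂ S|, ?_, fun s hs x hx S => ?_⟩
  · -- summable: finitely supported + two absolutely summable
    refine Summable.add (Summable.add ?_ hm₁.abs) hm₂.abs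
    refine summable_of_ne_finset_zero (s := {0}) fun S hS => ?_
    have hS0 : (S : Matrix (Fin n) (Fin n) L) ≠ 0 := fun h0 => hS (Finset.mem_singleton.2 (Subtype.ext h0))
    rw [if_neg hS0]
  · have hs₀ : dist s z < r₀ := lt_of_lt_of_le hs (min_le_left _ _)
    have hs₁ : dist s z < r₁ := lt_of_lt_of_le hs ((min_le_right _ _).trans (min_le_left _ _))
    have hs₂ : dist s z < r₂ := lt_of_lt_of_le hs ((min_le_right _ _).trans (min_le_right _ _))
    have hx₀ : x ∈ V₀ := hx.1
    have hx₁ : x ∈ V₁ := hx.2.1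
    have hx₂ : x ∈ V₂ := hx.2.2
    have hA : ‖(if (S : Matrix (Fin n) (Fin n) L) = 0 then Ec0 s x else 0)‖ ≤ (if (S : Matrix (Fin n) (Fin n) L) = 0 then max M 0 else 0) := by
      split_ifs with h
      · exact (h0 s hs₀ x hx₀).trans (le_max_left _ _)
      · rw [norm_zero]
    calc ‖(if (S : Matrix (Fin n) (Fin n) L) = 0 then Ec0 s x else 0) + Ec1 S s x + EcW S s x‖
        ≤ ‖(if (S : Matrix (Fin n) (Fin n) L) = 0 then Ec0 s x else 0) + Ec1 S s x‖ + ‖EcW S s x‖ := norm_add_le _ _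
      _ ≤ (‖(if (S : Matrix (Fin n) (Fin n) L) = 0 then Ec0 s x else 0)‖ + ‖Ec1 S s x‖) + ‖EcW S s x‖ :=
          add_le_add (norm_add_le _ _) le_rfl
      _ ≤ ((if (S : Matrix (Fin n) (Fin n) L) = 0 then max M 0 else 0) + |m₁ S|) + |m₂ S| :=
          add_le_add (add_le_add hA ((h1 s hs₁ x hx₁ S).trans (le_abs_self _))) ((h2 s hs₂ x hx₂ S).trans (le_abs_self _))

open Classical in
/-- **ONE GROWTH LETTER FROM THREE**: per-kind growth `‖Ec0 s x‖ ≤ C₀·hgt x^{A₀}`, `Σ'_S ‖Ec1 S s x‖ ≤ C₁·hgt x^{A₁}`, `Σ'_S ‖EcW S s x‖ ≤ C_W·hgt x^{A_W}` (locally uniformly in `s`), the two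
lattice families summable at every `(s, x)` of the ball (from their majorants), and a FLOOR `m ≤ hgt` (`0 < m`) ⇒ `Σ'_S ‖𝟙_{S=0}Ec0 + Ec1 S + EcW S‖ ≤ C·hgt x^A` locally uniformly —
Φ9's `hgrowth`. [cite: MoeglinWaldspurger1995, II.1.7, IV.1.9] [cite: Tan1999, §4 Prop. 4.8] -/
theorem growth_of_kinds {X : Type*} (hgt : X → ℝ) (hpos : ∀ x, 0 < hgt x) {mfl : ℝ} (hmfl : 0 < mfl) (hfloor : ∀ x, mfl ≤ hgt x)
    (Ec0 : ℂ → X → ℂ) (Ec1 EcW : skewMatrices ((IsCMField.complexConj L : L ≃ₐ[Fp L] L) : L →+* L) ((gramR L e dV hdV dW hdW).map (algebraMap (Fp L) L)) → ℂ → X → ℂ)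
    (hgr0 : ∀ z : ℂ, 0 < z.re → ∃ C A r : ℝ, 0 < r ∧ ∀ s : ℂ, dist s z < r → ∀ x, ‖Ec0 s x‖ ≤ C * hgt x ^ A)
    (hgr1 : ∀ z : ℂ, 0 < z.re → ∃ C A r : ℝ, 0 < r ∧ ∀ s : ℂ, dist s z < r → ∀ x,
      (Summable fun S => ‖Ec1 S s x‖) ∧ ∑' S, ‖Ec1 S s x‖ ≤ C * hgt x ^ A)
    (hWgr : ∀ z : ℂ, 0 < z.re → ∃ C A r : ℝ, 0 < r ∧ ∀ s : ℂ, dist s z < r → ∀ x,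
      (Summable fun S => ‖EcW S s x‖) ∧ ∑' S, ‖EcW S s x‖ ≤ C * hgt x ^ A) :
    ∀ z : ℂ, 0 < z.re → ∃ C A r : ℝ, 0 < r ∧ ∀ s : ℂ, dist s z < r → ∀ x,
      ∑' S : skewMatrices ((IsCMField.complexConj L : L ≃ₐ[Fp L] L) : L →+* L) ((gramR L e dV hdV dW hdW).map (algebraMap (Fp L) L)), ‖(if (S : Matrix (Fin n) (Fin n) L) = 0 then Ec0 s x else 0) + Ec1 S s x + EcW S s x‖ ≤ C * hgt x ^ A := by
  intro z hz
  obtain ⟨C₀, A₀, r₀, hr₀, h0⟩ := hgr0 z hz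
  obtain ⟨C₁, A₁, r₁, hr₁, h1⟩ := hgr1 z hz
  obtain ⟨C₂, A₂, r₂, hr₂, h2⟩ := hWgr z hz
  -- the merged constant and exponent (from the device, at an arbitrary point: they do not depend on the point)
  set A₀₁ : ℝ := max A₀ A₁ with hA₀₁
  set C₀₁ : ℝ := max C₀ 0 * mfl ^ (A₀ - A₀₁) + max C₁ 0 * mfl ^ (A₁ - A₀₁) with hC₀₁
  set A : ℝ := max A₀₁ A₂ with hA
  set C : ℝ := C₀₁ * mfl ^ (A₀₁ - A) + max C₂ 0 * mfl ^ (A₂ - A) with hC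
  refine ⟨C, A, min r₀ (min r₁ r₂), lt_min hr₀ (lt_min hr₁ hr₂), fun s hs x => ?_⟩
  have hs₀ : dist s z < r₀ := lt_of_lt_of_le hs (min_le_left _ _)
  have hs₁ : dist s z < r₁ := lt_of_lt_of_le hs ((min_le_right _ _).trans (min_le_left _ _))
  have hs₂ : dist s z < r₂ := lt_of_lt_of_le hs ((min_le_right _ _).trans (min_le_right _ _))
  have hx := (hpos x).le
  obtain ⟨hsum1, hle1⟩ := h1 s hs₁ x
  obtain ⟨hsum2, hle2⟩ := h2 s hs₂ x
  -- the indicator family: summable with sum `‖Ec0 s x‖`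
  have hind : HasSum (fun S : skewMatrices ((IsCMField.complexConj L : L ≃ₐ[Fp L] L) : L →+* L) ((gramR L e dV hdV dW hdW).map (algebraMap (Fp L) L)) =>
      ‖(if (S : Matrix (Fin n) (Fin n) L) = 0 then Ec0 s x else 0)‖) ‖Ec0 s x‖ := by
    have h := hasSum_ite_eq (0 : skewMatrices ((IsCMField.complexConj L : L ≃ₐ[Fp L] L) : L →+* L) ((gramR L e dV hdV dW hdW).map (algebraMap (Fp L) L))) ‖Ec0 s x‖
    refine h.congr_fun fun S => ?_
    by_cases hS : S = 0
    · subst hS; simp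
    · have hS' : (S : Matrix (Fin n) (Fin n) L) ≠ 0 := fun h0 => hS (Subtype.ext h0)
      rw [if_neg hS', if_neg hS, norm_zero]
  -- termwise triangle inequality, then sum
  have hterm : ∀ S : skewMatrices ((IsCMField.complexConj L : L ≃ₐ[Fp L] L) : L →+* L) ((gramR L e dV hdV dW hdW).map (algebraMap (Fp L) L)),
      ‖(if (S : Matrix (Fin n) (Fin n) L) = 0 then Ec0 s x else 0) + Ec1 S s x + EcW S s x‖ ≤
        ‖(if (S : Matrix (Fin n) (Fin n) L) = 0 then Ec0 s x else 0)‖ + ‖Ec1 S s x‖ + ‖EcW S s x‖ := fun S =>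
    (norm_add_le _ _).trans (add_le_add (norm_add_le _ _) le_rfl)
  have hsumR : Summable fun S : skewMatrices ((IsCMField.complexConj L : L ≃ₐ[Fp L] L) : L →+* L) ((gramR L e dV hdV dW hdW).map (algebraMap (Fp L) L)) =>
      ‖(if (S : Matrix (Fin n) (Fin n) L) = 0 then Ec0 s x else 0)‖ + ‖Ec1 S s x‖ + ‖EcW S s x‖ := (hind.summable.add hsum1).add hsum2
  have hsumL : Summable fun S : skewMatrices ((IsCMField.complexConj L : L ≃ₐ[Fp L] L) : L →+* L) ((gramR L e dV hdV dW hdW).map (algebraMap (Fp L) L)) =>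
      ‖(if (S : Matrix (Fin n) (Fin n) L) = 0 then Ec0 s x else 0) + Ec1 S s x + EcW S s x‖ :=
    Summable.of_nonneg_of_le (fun _ => norm_nonneg _) hterm hsumR
  have htsum : ∑' S : skewMatrices ((IsCMField.complexConj L : L ≃ₐ[Fp L] L) : L →+* L) ((gramR L e dV hdV dW hdW).map (algebraMap (Fp L) L)), ‖(if (S : Matrix (Fin n) (Fin n) L) = 0 then Ec0 s x else 0) + Ec1 S s x + EcW S s x‖ ≤
      ‖Ec0 s x‖ + ∑' S, ‖Ec1 S s x‖ + ∑' S, ‖EcW S s x‖ := by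
    calc ∑' S : skewMatrices ((IsCMField.complexConj L : L ≃ₐ[Fp L] L) : L →+* L) ((gramR L e dV hdV dW hdW).map (algebraMap (Fp L) L)), ‖(if (S : Matrix (Fin n) (Fin n) L) = 0 then Ec0 s x else 0) + Ec1 S s x + EcW S s x‖
        ≤ ∑' S : skewMatrices ((IsCMField.complexConj L : L ≃ₐ[Fp L] L) : L →+* L) ((gramR L e dV hdV dW hdW).map (algebraMap (Fp L) L)), (‖(if (S : Matrix (Fin n) (Fin n) L) = 0 then Ec0 s x else 0)‖ + ‖Ec1 S s x‖ + ‖EcW S s x‖) :=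
          Summable.tsum_le_tsum hterm hsumL hsumR
      _ = ‖Ec0 s x‖ + ∑' S, ‖Ec1 S s x‖ + ∑' S, ‖EcW S s x‖ := by
          rw [Summable.tsum_add (hind.summable.add hsum1) hsum2, Summable.tsum_add hind.summable hsum1, hind.tsum_eq]
  -- merge the three monomials under the floor
  have hu : ‖Ec0 s x‖ ≤ max C₀ 0 * hgt x ^ A₀ := le_max_mul_rpow hx (h0 s hs₀ x)
  have hv : ∑' S, ‖Ec1 S s x‖ ≤ max C₁ 0 * hgt x ^ A₁ := le_max_mul_rpow hx hle1
  have hw : ∑' S, ‖EcW S s x‖ ≤ max C₂ 0 * hgt x ^ A₂ := le_max_mul_rpow hx hle2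
  have h01 := add_le_merged_monomial hmfl (hfloor x) (le_max_right _ _) (le_max_right _ _) hu hv
  have hC₀₁0 : 0 ≤ C₀₁ := by positivity
  have h012 := add_le_merged_monomial hmfl (hfloor x) hC₀₁0 (le_max_right _ _) h01 hw
  exact htsum.trans h012

end Kinds

/-! ## §3 THE TOP, edition 3 — socket #41 from the three kinds -/

section Top3

open Classical in
/-- **SOCKET #41 FROM THE THREE KINDS OF FOURIER INDEX (edition 3).**  After the socket's own binders and the Borel structure on `N_Δ(𝔸)`: the pole set `P`; the CONSTANT TERM package
`Ec₀` ((i) `hd₀`, (ii) `hc₀`, the carrier-generic coefficient identity `hcoef₀` at `S = 0`, a local bound `hbd₀`, growth `hgr₀`; payers ★ rank-zero `exists_middle_package` + Φ8 ★ + identity);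
the RANK-ONE packages `Ec₁ S` (off-kind zero `h1off`; (i) `hd₁`, (ii) `hc₁` for every `S`; `hcoef₁` on `S ≠ 0`, `det S = 0`; majorant `hmaj₁`; summed growth `hgr₁`; payer ★
`exists_rankOne_package_cleared` at `X := H(𝔸)` + G4×G7); the WHITTAKER packages `EcW S` (off-kind zero `hWoff`; (i)(ii); `hWcoef` on `det S ≠ 0`; `hWmaj`; `hWgr`; payers G1–G4 + G7).
THEN socket #41's body, BYTES VERBATIM — via ★ edition 2 on the dispatched family `𝟙_{S=0}·Ec₀ + Ec₁ S + EcW S` (§2: one majorant, one growth letter under ★ `exists_height_floor`).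
[cite: Tan1999, §1 Main Theorem; §4 Props. 4.1, 4.4, 4.8] [cite: MoeglinWaldspurger1995, II.1.7, IV.1.8–IV.1.11] [cite: KudlaRallis1994, §1–§2] [cite: Liu2021, Lem. B.10 (2), B.12] -/
theorem siegelEisensteinContinuation_of_kinds
    (L : Type) [Field L] [NumberField L] [IsCMField L] {n : ℕ} (e : Fin 2 × Fin 1 ≃ Fin n)
    (dV : Fin 2 → L) (hdV : ∀ i, IsCMField.complexConj L (dV i) = dV i) (hdV0 : ∀ i, dV i ≠ 0)
    (dW : Fin 1 → L) (hdW : ∀ i, IsCMField.complexConj L (dW i) = dW i) (hdW0 : ∀ i, dW i ≠ 0)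
    (lam : IdeleClassGroup L →ₜ* Circle) (hlam : IsConjugateSymplectic L lam) (hw : HasWeight L lam 1)
    (𝒦 : IwasawaDatum L e dV hdV dW hdW) (h𝒦 : 𝒦.IsStd) (f : ℂ → HA L e dV hdV dW hdW → ℂ)
    (hstd : IsStandardSectionFamily 𝒦 (toHeckeCharacter L lam⁻¹) f) (hcont : ∀ s, Continuous (f s))
    [MeasurableSpace (unipDelta L e dV hdV dW hdW)] [BorelSpace (unipDelta L e dV hdV dW hdW)] (P : Finset ℂ)
    -- KIND 0: the constant term
    (Ec₀ : ℂ → HA L e dV hdV dW hdW → ℂ)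
    (hd₀ : ∀ h : HA L e dV hdV dW hdW, DifferentiableOn ℂ (fun s => Ec₀ s h) {s : ℂ | 0 < s.re})
    (hc₀ : ∀ s : ℂ, 0 < s.re → Continuous (Ec₀ s))
    (hcoef₀ : ∀ (νN : Measure (unipDelta L e dV hdV dW hdW)) [νN.IsHaarMeasure] (β : unipDelta L e dV hdV dW hdW → ℝ≥0∞),
      IsCoveringWeight (unipDeltaRat L e dV hdV dW hdW) β → ∫⁻ u, β u ∂νN ≠ 0 → ∫⁻ u, β u ∂νN ≠ ∞ →
      ∀ (s : ℂ) (h : HA L e dV hdV dW hdW), (n : ℝ) / 2 < s.re →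
        Ec₀ s h = (∏ p ∈ P, (s - p)) * fourierCoeffDelta L e dV hdV dW hdW νN β 0 (eisensteinFamilyDelta L e dV hdV dW hdW f s) h)
    (hbd₀ : ∀ z : ℂ, 0 < z.re → ∀ h₀ : HA L e dV hdV dW hdW, ∃ r > (0 : ℝ), ∃ V ∈ 𝓝 h₀, ∃ Mb : ℝ, ∀ s : ℂ, dist s z < r → ∀ h ∈ V, ‖Ec₀ s h‖ ≤ Mb)
    (hgr₀ : ∀ z : ℂ, 0 < z.re → ∃ C A r : ℝ, 0 < r ∧ ∀ s : ℂ, dist s z < r → ∀ h : HA L e dV hdV dW hdW,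
      ‖Ec₀ s h‖ ≤ C * adelicHeightGL (n + n) L (h : GL (Fin (n + n)) (AdeleRing (𝓞 L) L)) ^ A)
    -- KIND 1: rank one (CLEARED currency), extended by zero off kind
    (Ec₁ : skewMatrices ((IsCMField.complexConj L : L ≃ₐ[Fp L] L) : L →+* L) ((gramR L e dV hdV dW hdW).map (algebraMap (Fp L) L)) → ℂ → HA L e dV hdV dW hdW → ℂ)
    (h1off : ∀ S : skewMatrices ((IsCMField.complexConj L : L ≃ₐ[Fp L] L) : L →+* L) ((gramR L e dV hdV dW hdW).map (algebraMap (Fp L) L)), ¬ ((S : Matrix (Fin n) (Fin n) L) ≠ 0 ∧ (S : Matrix (Fin n) (Fin n) L).det = 0) → ∀ s h, Ec₁ S s h = 0)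
    (hd₁ : ∀ S (h : HA L e dV hdV dW hdW), DifferentiableOn ℂ (fun s => Ec₁ S s h) {s : ℂ | 0 < s.re})
    (hc₁ : ∀ S (s : ℂ), 0 < s.re → Continuous (Ec₁ S s))
    (hcoef₁ : ∀ (νN : Measure (unipDelta L e dV hdV dW hdW)) [νN.IsHaarMeasure] (β : unipDelta L e dV hdV dW hdW → ℝ≥0∞),
      IsCoveringWeight (unipDeltaRat L e dV hdV dW hdW) β → ∫⁻ u, β u ∂νN ≠ 0 → ∫⁻ u, β u ∂νN ≠ ∞ →
      ∀ (S : skewMatrices ((IsCMField.complexConj L : L ≃ₐ[Fp L] L) : L →+* L) ((gramR L e dV hdV dW hdW).map (algebraMap (Fp L) L))),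
        (S : Matrix (Fin n) (Fin n) L) ≠ 0 → (S : Matrix (Fin n) (Fin n) L).det = 0 →
      ∀ (s : ℂ) (h : HA L e dV hdV dW hdW), (n : ℝ) / 2 < s.re →
        Ec₁ S s h = (∏ p ∈ P, (s - p)) * fourierCoeffDelta L e dV hdV dW hdW νN β (S : Matrix (Fin n) (Fin n) L) (eisensteinFamilyDelta L e dV hdV dW hdW f s) h)
    (hmaj₁ : ∀ z : ℂ, 0 < z.re → ∀ h₀ : HA L e dV hdV dW hdW, ∃ r > (0 : ℝ), ∃ V ∈ 𝓝 h₀,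
      ∃ m : skewMatrices ((IsCMField.complexConj L : L ≃ₐ[Fp L] L) : L →+* L) ((gramR L e dV hdV dW hdW).map (algebraMap (Fp L) L)) → ℝ, Summable m ∧
        ∀ s : ℂ, dist s z < r → ∀ h ∈ V, ∀ S, ‖Ec₁ S s h‖ ≤ m S)
    (hgr₁ : ∀ z : ℂ, 0 < z.re → ∃ C A r : ℝ, 0 < r ∧ ∀ s : ℂ, dist s z < r → ∀ h : HA L e dV hdV dW hdW,
      (Summable fun S => ‖Ec₁ S s h‖) ∧ ∑' S, ‖Ec₁ S s h‖ ≤ C * adelicHeightGL (n + n) L (h : GL (Fin (n + n)) (AdeleRing (𝓞 L) L)) ^ A)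
    -- KIND W: non-degenerate (Whittaker), extended by zero off kind
    (EcW : skewMatrices ((IsCMField.complexConj L : L ≃ₐ[Fp L] L) : L →+* L) ((gramR L e dV hdV dW hdW).map (algebraMap (Fp L) L)) → ℂ → HA L e dV hdV dW hdW → ℂ)
    (hWoff : ∀ S : skewMatrices ((IsCMField.complexConj L : L ≃ₐ[Fp L] L) : L →+* L) ((gramR L e dV hdV dW hdW).map (algebraMap (Fp L) L)), (S : Matrix (Fin n) (Fin n) L).det = 0 → ∀ s h, EcW S s h = 0)
    (hWd : ∀ S (h : HA L e dV hdV dW hdW), DifferentiableOn ℂ (fun s => EcW S s h) {s : ℂ | 0 < s.re})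
    (hWc : ∀ S (s : ℂ), 0 < s.re → Continuous (EcW S s))
    (hWcoef : ∀ (νN : Measure (unipDelta L e dV hdV dW hdW)) [νN.IsHaarMeasure] (β : unipDelta L e dV hdV dW hdW → ℝ≥0∞),
      IsCoveringWeight (unipDeltaRat L e dV hdV dW hdW) β → ∫⁻ u, β u ∂νN ≠ 0 → ∫⁻ u, β u ∂νN ≠ ∞ →
      ∀ (S : skewMatrices ((IsCMField.complexConj L : L ≃ₐ[Fp L] L) : L →+* L) ((gramR L e dV hdV dW hdW).map (algebraMap (Fp L) L))),
        (S : Matrix (Fin n) (Fin n) L).det ≠ 0 →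
      ∀ (s : ℂ) (h : HA L e dV hdV dW hdW), (n : ℝ) / 2 < s.re →
        EcW S s h = (∏ p ∈ P, (s - p)) * fourierCoeffDelta L e dV hdV dW hdW νN β (S : Matrix (Fin n) (Fin n) L) (eisensteinFamilyDelta L e dV hdV dW hdW f s) h)
    (hWmaj : ∀ z : ℂ, 0 < z.re → ∀ h₀ : HA L e dV hdV dW hdW, ∃ r > (0 : ℝ), ∃ V ∈ 𝓝 h₀,
      ∃ m : skewMatrices ((IsCMField.complexConj L : L ≃ₐ[Fp L] L) : L →+* L) ((gramR L e dV hdV dW hdW).map (algebraMap (Fp L) L)) → ℝ, Summable m ∧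
        ∀ s : ℂ, dist s z < r → ∀ h ∈ V, ∀ S, ‖EcW S s h‖ ≤ m S)
    (hWgr : ∀ z : ℂ, 0 < z.re → ∃ C A r : ℝ, 0 < r ∧ ∀ s : ℂ, dist s z < r → ∀ h : HA L e dV hdV dW hdW,
      (Summable fun S => ‖EcW S s h‖) ∧ ∑' S, ‖EcW S s h‖ ≤ C * adelicHeightGL (n + n) L (h : GL (Fin (n + n)) (AdeleRing (𝓞 L) L)) ^ A) :
    ∃ (P : Finset ℂ) (Es : ℂ → HA L e dV hdV dW hdW → ℂ),
      (∀ h : HA L e dV hdV dW hdW, DifferentiableOn ℂ (fun s => Es s h) {s : ℂ | 0 < s.re}) ∧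
      (∀ s : ℂ, 0 < s.re → Continuous (Es s)) ∧
      (∀ s : ℂ, 0 < s.re → ∀ (γ : ratH L e dV hdV dW hdW) (h : HA L e dV hdV dW hdW),
        Es s ((γ : HA L e dV hdV dW hdW) * h) = Es s h) ∧
      (∀ (s : ℂ) (h : HA L e dV hdV dW hdW), (n : ℝ) / 2 < s.re →
        Es s h = (∏ p ∈ P, (s - p)) * eisensteinFamilyDelta L e dV hdV dW hdW f s h) ∧
      (∀ z : ℂ, 0 < z.re → ∃ C A r : ℝ, 0 < r ∧ ∀ s : ℂ, dist s z < r → ∀ h : HA L e dV hdV dW hdW,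
        ‖Es s h‖ ≤ C * adelicHeightGL (n + n) L (h : GL (Fin (n + n)) (AdeleRing (𝓞 L) L)) ^ A) := by
  -- the frame has `n = 2 > 0`, so `H(𝔸)` has a height floor
  have hn : 0 < n := by
    have h2 : Fintype.card (Fin 2 × Fin 1) = Fintype.card (Fin n) := Fintype.card_congr e
    simp only [Fintype.card_prod, Fintype.card_fin] at h2
    omega
  obtain ⟨mfl, hmfl, hfloor⟩ := exists_height_floor L e dV hdV dW hdW hn
  have hHpos : ∀ h : HA L e dV hdV dW hdW, 0 < adelicHeightGL (n + n) L (h : GL (Fin (n + n)) (AdeleRing (𝓞 L) L)) :=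
    fun h => hmfl.trans_le (hfloor h)
  -- the dispatched family
  refine siegelEisensteinContinuation_of_rows₂ L e dV hdV hdV0 dW hdW hdW0 lam hlam hw 𝒦 h𝒦 f hstd hcont P
    (fun (S : skewMatrices ((IsCMField.complexConj L : L ≃ₐ[Fp L] L) : L →+* L) ((gramR L e dV hdV dW hdW).map (algebraMap (Fp L) L))) s h => (if (S : Matrix (Fin n) (Fin n) L) = 0 then Ec₀ s h else 0) + Ec₁ S s h + EcW S s h) ?_ ?_ ?_ ?_ ?_
  · -- (i) holomorphy
    intro S h
    have h0 : DifferentiableOn ℂ (fun s => if (S : Matrix (Fin n) (Fin n) L) = 0 then Ec₀ s h else 0) {s : ℂ | 0 < s.re} := by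
      split_ifs
      · exact hd₀ h
      · exact differentiableOn_const 0
    exact (h0.add (hd₁ S h)).add (hWd S h)
  · -- (ii) continuity
    intro S s hs
    have h0 : Continuous fun h => if (S : Matrix (Fin n) (Fin n) L) = 0 then Ec₀ s h else 0 := by
      split_ifs
      · exact hc₀ s hs
      · exact continuous_const
    exact (h0.add (hc₁ S s hs)).add (hWc S s hs)
  · -- the coefficient identity, kind by kind
    intro νN _ β hβ hβ0 hβtop S s h hs
    by_cases hS0 : (S : Matrix (Fin n) (Fin n) L) = 0
    · have hdet : (S : Matrix (Fin n) (Fin n) L).det = 0 := by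
        haveI : Nonempty (Fin n) := ⟨⟨0, hn⟩⟩
        rw [hS0]; exact Matrix.det_zero
      rw [if_pos hS0, h1off S (fun hh => hh.1 hS0) s h, hWoff S hdet s h, add_zero, add_zero, hcoef₀ νN β hβ hβ0 hβtop s h hs, hS0]
    · by_cases hdet : (S : Matrix (Fin n) (Fin n) L).det = 0
      · rw [if_neg hS0, hWoff S hdet s h, zero_add, add_zero]
        exact hcoef₁ νN β hβ hβ0 hβtop S hS0 hdet s h hs
      · rw [if_neg hS0, h1off S (fun hh => hdet hh.2) s h, zero_add, zero_add]
        exact hWcoef νN β hβ hβ0 hβtop S hdet s h hs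
  · -- one majorant
    exact majorant_of_kinds L e dV hdV dW hdW Ec₀ Ec₁ EcW hbd₀ hmaj₁ hWmaj
  · -- one growth letter
    exact growth_of_kinds L e dV hdV dW hdW (fun h : HA L e dV hdV dW hdW => adelicHeightGL (n + n) L (h : GL (Fin (n + n)) (AdeleRing (𝓞 L) L)))
      hHpos hmfl hfloor Ec₀ Ec₁ EcW hgr₀ hgr₁ hWgr

end Top3
/-! ## §4 Edition 3b — the three kinds over a FIXED Fourier carrier (edition 1's currency) -/
section Top3b

open Classical in
/-- **SOCKET #41 FROM THE THREE KINDS OVER A FIXED CARRIER (edition 3b)**: as `…_of_kinds`, but the carrier `(νN, β)` is a BINDER (★ edition 1's currency) and the three coefficient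
identities are stated for THAT carrier (payers may use `whittakerDelta νN`, `intertwiningDelta νN`, the weighted middle cell). [cite: Tan1999, §4 Props. 4.1, 4.4, 4.8] [cite: KudlaRallis1994, §1–§2] -/
theorem siegelEisensteinContinuation_of_kinds_fixedCarrier
    (L : Type) [Field L] [NumberField L] [IsCMField L] {n : ℕ} (e : Fin 2 × Fin 1 ≃ Fin n)
    (dV : Fin 2 → L) (hdV : ∀ i, IsCMField.complexConj L (dV i) = dV i) (hdV0 : ∀ i, dV i ≠ 0)
    (dW : Fin 1 → L) (hdW : ∀ i, IsCMField.complexConj L (dW i) = dW i) (hdW0 : ∀ i, dW i ≠ 0)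
    (lam : IdeleClassGroup L →ₜ* Circle) (hlam : IsConjugateSymplectic L lam) (hw : HasWeight L lam 1)
    (𝒦 : IwasawaDatum L e dV hdV dW hdW) (h𝒦 : 𝒦.IsStd) (f : ℂ → HA L e dV hdV dW hdW → ℂ)
    (hstd : IsStandardSectionFamily 𝒦 (toHeckeCharacter L lam⁻¹) f) (hcont : ∀ s, Continuous (f s))
    [MeasurableSpace (unipDelta L e dV hdV dW hdW)] [BorelSpace (unipDelta L e dV hdV dW hdW)]
    (νN : Measure (unipDelta L e dV hdV dW hdW)) [νN.IsMulLeftInvariant]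
    (β : unipDelta L e dV hdV dW hdW → ℝ≥0∞) (hβ : IsCoveringWeight (unipDeltaRat L e dV hdV dW hdW) β)
    (hβ0 : ∫⁻ u, β u ∂νN ≠ 0) (hβtop : ∫⁻ u, β u ∂νN ≠ ∞) (P : Finset ℂ)
    (Ec₀ : ℂ → HA L e dV hdV dW hdW → ℂ)
    (hd₀ : ∀ h : HA L e dV hdV dW hdW, DifferentiableOn ℂ (fun s => Ec₀ s h) {s : ℂ | 0 < s.re})
    (hc₀ : ∀ s : ℂ, 0 < s.re → Continuous (Ec₀ s))
    (hcoef₀ : ∀ (s : ℂ) (h : HA L e dV hdV dW hdW), (n : ℝ) / 2 < s.re →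
      Ec₀ s h = (∏ p ∈ P, (s - p)) * fourierCoeffDelta L e dV hdV dW hdW νN β 0 (eisensteinFamilyDelta L e dV hdV dW hdW f s) h)
    (hbd₀ : ∀ z : ℂ, 0 < z.re → ∀ h₀ : HA L e dV hdV dW hdW, ∃ r > (0 : ℝ), ∃ V ∈ 𝓝 h₀, ∃ Mb : ℝ, ∀ s : ℂ, dist s z < r → ∀ h ∈ V, ‖Ec₀ s h‖ ≤ Mb)
    (hgr₀ : ∀ z : ℂ, 0 < z.re → ∃ C A r : ℝ, 0 < r ∧ ∀ s : ℂ, dist s z < r → ∀ h : HA L e dV hdV dW hdW,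
      ‖Ec₀ s h‖ ≤ C * adelicHeightGL (n + n) L (h : GL (Fin (n + n)) (AdeleRing (𝓞 L) L)) ^ A)
    (Ec₁ : skewMatrices ((IsCMField.complexConj L : L ≃ₐ[Fp L] L) : L →+* L) ((gramR L e dV hdV dW hdW).map (algebraMap (Fp L) L)) → ℂ → HA L e dV hdV dW hdW → ℂ)
    (h1off : ∀ S : skewMatrices ((IsCMField.complexConj L : L ≃ₐ[Fp L] L) : L →+* L) ((gramR L e dV hdV dW hdW).map (algebraMap (Fp L) L)), ¬ ((S : Matrix (Fin n) (Fin n) L) ≠ 0 ∧ (S : Matrix (Fin n) (Fin n) L).det = 0) → ∀ s h, Ec₁ S s h = 0)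
    (hd₁ : ∀ S (h : HA L e dV hdV dW hdW), DifferentiableOn ℂ (fun s => Ec₁ S s h) {s : ℂ | 0 < s.re})
    (hc₁ : ∀ S (s : ℂ), 0 < s.re → Continuous (Ec₁ S s))
    (hcoef₁ : ∀ (S : skewMatrices ((IsCMField.complexConj L : L ≃ₐ[Fp L] L) : L →+* L) ((gramR L e dV hdV dW hdW).map (algebraMap (Fp L) L))), (S : Matrix (Fin n) (Fin n) L) ≠ 0 → (S : Matrix (Fin n) (Fin n) L).det = 0 →
      ∀ (s : ℂ) (h : HA L e dV hdV dW hdW), (n : ℝ) / 2 < s.re →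
        Ec₁ S s h = (∏ p ∈ P, (s - p)) * fourierCoeffDelta L e dV hdV dW hdW νN β (S : Matrix (Fin n) (Fin n) L) (eisensteinFamilyDelta L e dV hdV dW hdW f s) h)
    (hmaj₁ : ∀ z : ℂ, 0 < z.re → ∀ h₀ : HA L e dV hdV dW hdW, ∃ r > (0 : ℝ), ∃ V ∈ 𝓝 h₀,
      ∃ m : skewMatrices ((IsCMField.complexConj L : L ≃ₐ[Fp L] L) : L →+* L) ((gramR L e dV hdV dW hdW).map (algebraMap (Fp L) L)) → ℝ, Summable m ∧ ∀ s : ℂ, dist s z < r → ∀ h ∈ V, ∀ S, ‖Ec₁ S s h‖ ≤ m S)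
    (hgr₁ : ∀ z : ℂ, 0 < z.re → ∃ C A r : ℝ, 0 < r ∧ ∀ s : ℂ, dist s z < r → ∀ h : HA L e dV hdV dW hdW,
      (Summable fun S => ‖Ec₁ S s h‖) ∧ ∑' S, ‖Ec₁ S s h‖ ≤ C * adelicHeightGL (n + n) L (h : GL (Fin (n + n)) (AdeleRing (𝓞 L) L)) ^ A)
    (EcW : skewMatrices ((IsCMField.complexConj L : L ≃ₐ[Fp L] L) : L →+* L) ((gramR L e dV hdV dW hdW).map (algebraMap (Fp L) L)) → ℂ → HA L e dV hdV dW hdW → ℂ)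
    (hWoff : ∀ S : skewMatrices ((IsCMField.complexConj L : L ≃ₐ[Fp L] L) : L →+* L) ((gramR L e dV hdV dW hdW).map (algebraMap (Fp L) L)), (S : Matrix (Fin n) (Fin n) L).det = 0 → ∀ s h, EcW S s h = 0)
    (hWd : ∀ S (h : HA L e dV hdV dW hdW), DifferentiableOn ℂ (fun s => EcW S s h) {s : ℂ | 0 < s.re})
    (hWc : ∀ S (s : ℂ), 0 < s.re → Continuous (EcW S s))
    (hWcoef : ∀ (S : skewMatrices ((IsCMField.complexConj L : L ≃ₐ[Fp L] L) : L →+* L) ((gramR L e dV hdV dW hdW).map (algebraMap (Fp L) L))), (S : Matrix (Fin n) (Fin n) L).det ≠ 0 →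
      ∀ (s : ℂ) (h : HA L e dV hdV dW hdW), (n : ℝ) / 2 < s.re →
        EcW S s h = (∏ p ∈ P, (s - p)) * fourierCoeffDelta L e dV hdV dW hdW νN β (S : Matrix (Fin n) (Fin n) L) (eisensteinFamilyDelta L e dV hdV dW hdW f s) h)
    (hWmaj : ∀ z : ℂ, 0 < z.re → ∀ h₀ : HA L e dV hdV dW hdW, ∃ r > (0 : ℝ), ∃ V ∈ 𝓝 h₀,
      ∃ m : skewMatrices ((IsCMField.complexConj L : L ≃ₐ[Fp L] L) : L →+* L) ((gramR L e dV hdV dW hdW).map (algebraMap (Fp L) L)) → ℝ, Summable m ∧ ∀ s : ℂ, dist s z < r → ∀ h ∈ V, ∀ S, ‖EcW S s h‖ ≤ m S)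
    (hWgr : ∀ z : ℂ, 0 < z.re → ∃ C A r : ℝ, 0 < r ∧ ∀ s : ℂ, dist s z < r → ∀ h : HA L e dV hdV dW hdW,
      (Summable fun S => ‖EcW S s h‖) ∧ ∑' S, ‖EcW S s h‖ ≤ C * adelicHeightGL (n + n) L (h : GL (Fin (n + n)) (AdeleRing (𝓞 L) L)) ^ A) :
    ∃ (P : Finset ℂ) (Es : ℂ → HA L e dV hdV dW hdW → ℂ),
      (∀ h : HA L e dV hdV dW hdW, DifferentiableOn ℂ (fun s => Es s h) {s : ℂ | 0 < s.re}) ∧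
      (∀ s : ℂ, 0 < s.re → Continuous (Es s)) ∧
      (∀ s : ℂ, 0 < s.re → ∀ (γ : ratH L e dV hdV dW hdW) (h : HA L e dV hdV dW hdW),
        Es s ((γ : HA L e dV hdV dW hdW) * h) = Es s h) ∧
      (∀ (s : ℂ) (h : HA L e dV hdV dW hdW), (n : ℝ) / 2 < s.re →
        Es s h = (∏ p ∈ P, (s - p)) * eisensteinFamilyDelta L e dV hdV dW hdW f s h) ∧
      (∀ z : ℂ, 0 < z.re → ∃ C A r : ℝ, 0 < r ∧ ∀ s : ℂ, dist s z < r → ∀ h : HA L e dV hdV dW hdW,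
        ‖Es s h‖ ≤ C * adelicHeightGL (n + n) L (h : GL (Fin (n + n)) (AdeleRing (𝓞 L) L)) ^ A) := by
  have hn : 0 < n := by
    have h2 : Fintype.card (Fin 2 × Fin 1) = Fintype.card (Fin n) := Fintype.card_congr e
    simp only [Fintype.card_prod, Fintype.card_fin] at h2
    omega
  obtain ⟨mfl, hmfl, hfloor⟩ := exists_height_floor L e dV hdV dW hdW hn
  have hHpos : ∀ h : HA L e dV hdV dW hdW, 0 < adelicHeightGL (n + n) L (h : GL (Fin (n + n)) (AdeleRing (𝓞 L) L)) :=
    fun h => hmfl.trans_le (hfloor h)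
  refine siegelEisensteinContinuation_of_rows L e dV hdV hdV0 dW hdW hdW0 lam hlam hw 𝒦 h𝒦 f hstd hcont νN β hβ hβ0 hβtop P
    (fun (S : skewMatrices ((IsCMField.complexConj L : L ≃ₐ[Fp L] L) : L →+* L) ((gramR L e dV hdV dW hdW).map (algebraMap (Fp L) L))) s h => (if (S : Matrix (Fin n) (Fin n) L) = 0 then Ec₀ s h else 0) + Ec₁ S s h + EcW S s h) ?_ ?_ ?_ ?_ ?_
  · intro S h
    have h0 : DifferentiableOn ℂ (fun s => if (S : Matrix (Fin n) (Fin n) L) = 0 then Ec₀ s h else 0) {s : ℂ | 0 < s.re} := by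
      split_ifs
      · exact hd₀ h
      · exact differentiableOn_const 0
    exact (h0.add (hd₁ S h)).add (hWd S h)
  · intro S s hs
    have h0 : Continuous fun h => if (S : Matrix (Fin n) (Fin n) L) = 0 then Ec₀ s h else 0 := by
      split_ifs
      · exact hc₀ s hs
      · exact continuous_const
    exact (h0.add (hc₁ S s hs)).add (hWc S s hs)
  · intro S s h hs
    by_cases hS0 : (S : Matrix (Fin n) (Fin n) L) = 0
    · have hdet : (S : Matrix (Fin n) (Fin n) L).det = 0 := by
        haveI : Nonempty (Fin n) := ⟨⟨0, hn⟩⟩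
        rw [hS0]; exact Matrix.det_zero
      rw [if_pos hS0, h1off S (fun hh => hh.1 hS0) s h, hWoff S hdet s h, add_zero, add_zero, hcoef₀ s h hs, hS0]
    · by_cases hdet : (S : Matrix (Fin n) (Fin n) L).det = 0
      · rw [if_neg hS0, hWoff S hdet s h, zero_add, add_zero]
        exact hcoef₁ S hS0 hdet s h hs
      · rw [if_neg hS0, h1off S (fun hh => hdet hh.2) s h, zero_add, zero_add]
        exact hWcoef S hdet s h hs
  · exact majorant_of_kinds L e dV hdV dW hdW Ec₀ Ec₁ EcW hbd₀ hmaj₁ hWmaj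
  · exact growth_of_kinds L e dV hdV dW hdW (fun h : HA L e dV hdV dW hdW => adelicHeightGL (n + n) L (h : GL (Fin (n + n)) (AdeleRing (𝓞 L) L)))
      hHpos hmfl hfloor Ec₀ Ec₁ EcW hgr₀ hgr₁ hWgr

end Top3b

end Summit.HodgeConjecture.HodgeConjecture.Cruxes.HLiu418.K2LiuSiegelEisensteinContinuationTopKinds

end
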